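import Mathlib.Probability.Independence.InfinitePi
import Summits.Ventures.PercRepro0.Defs

/-! # F5 in Lean: independence over disjoint bond sets (p5)

ROUTE-v3/v4 F5 (FOUNDATIONS-p5 Theorem F5, two-set form), formalised on Mathlib's `setBernoulli`:

* `coordSigma e` is the σ-algebra generated by the coordinate `ω ↦ (e ∈ ω)`, `sigmaOn E = ⨆ e ∈ E, coordSigma e`
  is `F_E`, the σ-algebra of events measurable with respect to the bonds of `E`;
* `iIndepFun_mem_setBernoulli`: under `setBer(u, p)` the coordinates `(e ∈ ω)_e` are mutually independent
  (pulled back from Mathlib's `iIndepFun_infinitePi` through `setBernoulli_apply'`);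
* `indep_sigmaOn_of_disjoint`: for disjoint `E₁, E₂` (finite or infinite) the σ-algebras `F_{E₁}`, `F_{E₂}` are
  independent (Mathlib's `indep_iSup_of_disjoint`), hence `setBernoulli_inter_eq_mul_of_disjoint`:
  `P(A ∩ B) = P(A) P(B)` for `A ∈ F_{E₁}`, `B ∈ F_{E₂}`;
* the percolation instance `P_indep_sigmaOn_of_disjoint`, and `measurableSet_coordSigma_mem`: `{ω : e ∈ ω} ∈ F_E` for `e ∈ E`.
-/

namespace Summit.Ventures.PercRepro0.Defs

open MeasureTheory ProbabilityTheory unitInterval Set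
open scoped ENNReal

section Independence

variable {ι : Type*}

/-- The σ-algebra generated by the coordinate `ω ↦ (e ∈ ω)`. -/
abbrev coordSigma (e : ι) : MeasurableSpace (Set ι) :=
  MeasurableSpace.comap (fun ω : Set ι => e ∈ ω) inferInstance

/-- `F_E`: the σ-algebra generated by the coordinates of the bonds in `E`. -/
abbrev sigmaOn (E : Set ι) : MeasurableSpace (Set ι) := ⨆ e ∈ E, coordSigma e

/-- The coordinate σ-algebras are sub-σ-algebras of the product σ-algebra. -/
theorem coordSigma_le (e : ι) : coordSigma e ≤ Set.instMeasurableSpace :=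
  (measurable_set_mem e).comap_le

/-- `F_E` is a sub-σ-algebra of the product σ-algebra. -/
theorem sigmaOn_le (E : Set ι) : sigmaOn E ≤ Set.instMeasurableSpace :=
  iSup₂_le fun e _ => coordSigma_le e

/-- `F_E` is monotone in `E`. -/
theorem sigmaOn_mono {E₁ E₂ : Set ι} (h : E₁ ⊆ E₂) : sigmaOn E₁ ≤ sigmaOn E₂ :=
  iSup₂_le fun e he => le_iSup₂ (f := fun e (_ : e ∈ E₂) => coordSigma e) e (h he)

/-- The coordinate event `{ω : e ∈ ω}` is measurable for `coordSigma e`. -/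
theorem measurableSet_coordSigma_mem (e : ι) : MeasurableSet[coordSigma e] {ω : Set ι | e ∈ ω} :=
  ⟨{q : Prop | q}, trivial, rfl⟩

/-- The coordinate event `{ω : e ∈ ω}` is `F_E`-measurable for `e ∈ E`. -/
theorem measurableSet_sigmaOn_mem {E : Set ι} {e : ι} (he : e ∈ E) :
    MeasurableSet[sigmaOn E] {ω : Set ι | e ∈ ω} :=
  (le_iSup₂ (f := fun e (_ : e ∈ E) => coordSigma e) e he) _ (measurableSet_coordSigma_mem e)

/-- Under `setBer(u, p)` the coordinates `ω ↦ (e ∈ ω)` are mutually independent. -/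
theorem iIndepFun_mem_setBernoulli (u : Set ι) (p : I) :
    iIndepFun (fun e : ι => fun ω : Set ι => e ∈ ω) (setBernoulli u p) := by
  rw [iIndepFun_iff_measure_inter_preimage_eq_mul]
  intro S sets hsets
  have hind : iIndepFun (fun i : ι => fun P : ι → Prop => P i)
      (Measure.infinitePi fun i : ι =>
        toNNReal p • Measure.dirac (i ∈ u) + toNNReal (σ p) • Measure.dirac False) :=
    iIndepFun_infinitePi (X := fun _ : ι => id) fun _ => measurable_id
  have h := (iIndepFun_iff_measure_inter_preimage_eq_mul.1 hind) S hsets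
  rw [setBernoulli_apply', Set.preimage_iInter₂]
  simp_rw [setBernoulli_apply', Set.preimage_preimage]
  exact h

/-- The coordinate σ-algebras are mutually independent under `setBer(u, p)`. -/
theorem iIndep_coordSigma (u : Set ι) (p : I) : iIndep coordSigma (setBernoulli u p) :=
  (iIndepFun_iff_iIndep _ _ _).1 (iIndepFun_mem_setBernoulli u p)

/-- F5 (two-set form): for disjoint bond sets `E₁, E₂`, the σ-algebras `F_{E₁}` and `F_{E₂}` are independent
under `setBer(u, p)`. -/
theorem indep_sigmaOn_of_disjoint (u : Set ι) (p : I) {E₁ E₂ : Set ι} (h : Disjoint E₁ E₂) :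
    Indep (sigmaOn E₁) (sigmaOn E₂) (setBernoulli u p) :=
  indep_iSup_of_disjoint (fun e => coordSigma_le e) (iIndep_coordSigma u p) h

/-- F5, event form: `P(A ∩ B) = P(A) P(B)` for `A ∈ F_{E₁}`, `B ∈ F_{E₂}`, `E₁ ∩ E₂ = ∅`. -/
theorem setBernoulli_inter_eq_mul_of_disjoint (u : Set ι) (p : I) {E₁ E₂ : Set ι}
    (h : Disjoint E₁ E₂) {A B : Set (Set ι)} (hA : MeasurableSet[sigmaOn E₁] A)
    (hB : MeasurableSet[sigmaOn E₂] B) :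
    setBernoulli u p (A ∩ B) = setBernoulli u p A * setBernoulli u p B :=
  (Indep_iff _ _ _).1 (indep_sigmaOn_of_disjoint u p h) A B hA hB

end Independence

variable {d : ℕ}

/-- F5 for the percolation measure: events measurable w.r.t. disjoint bond sets are independent. -/
theorem P_indep_sigmaOn_of_disjoint (p : I) {E₁ E₂ : Set (Sym2 (Vertex d))} (h : Disjoint E₁ E₂) :
    Indep (sigmaOn E₁) (sigmaOn E₂) (P d p) :=
  indep_sigmaOn_of_disjoint (bonds d) p h

/-- F5 for the percolation measure, event form. -/
theorem P_inter_eq_mul_of_disjoint (p : I) {E₁ E₂ : Set (Sym2 (Vertex d))} (h : Disjoint E₁ E₂)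
    {A B : Set (Config d)} (hA : MeasurableSet[sigmaOn E₁] A) (hB : MeasurableSet[sigmaOn E₂] B) :
    P d p (A ∩ B) = P d p A * P d p B :=
  setBernoulli_inter_eq_mul_of_disjoint (bonds d) p h hA hB

end Summit.Ventures.PercRepro0.Defs
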